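import Summits.QuantumFields.YangMills.Theorems.BalabanUVNodesN11NoExpansionTStepZhPinOfSolvable

/-!
# DAG node N11 — THE CUBE-COVER ROW `hcov` OF THE NO-EXPANSION 𝐓-STEP IS REDUNDANT: it follows from the faces' own `PartCompat₁₃` (the `𝐃_j` grid divides the torus)
# and ONE scalar divisibility, the NESTING NUMERIC `L·M₂ ∣ M` («M a multiple of LM₂»): every `M R_j`-cube of `𝐃_j` is a union of `L M₂ R_j`-cubes of the (2.17) partition

HEADER — WORK-UNIT METADATA.  Cell `pub-ymgap`, YM-PLAN Track A (HUMAN RULING D-0062 ∕ D-0149 width seats), seat `pub-ymgap-dag-n11-w4` (g3; WIDTH SEAT 4 of 4 on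
NODE n11 [B14]), route `BalabanUVNodes`, item K1⁷ `StabilityBAtRecordR13SepCoPH` = stmt-QuantumFields-20542 (helper, `--kind proof --supports 20542 --as helper`, count-neutral).
[III] = [Balaban1988Convergent], [I] = [Balaban1987RG1].  Over dag-n11-d g13's `…N11NoExpansionTStepZhPinOfSolvable` (p604229: the no-expansion 𝐓-step in the ZhPin class from
K0's rows + structural rows; its §1 `regOn_cutSel_of_zhPin_of_solvable` and §2's two ★★★★★ faces DISPLAY the cube-cover row `hcov`), node00-def-K0b's torus cube geometry
`Node00/Record12BgRowCubeGeometry` (★ `cubeEnl_subset_of_meets_unionsOfCubes`: an `s`-cube of the grid meeting a union of `(s·t)`-cubes lies inside it, `s·t ∣ sitesPerDir 0`),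
dag-n20-d's `B15Claim189CubePin` (`cubeOfSite`, `mem_cubeEnl_cubeOfSite`, `cubeOfSite_mem_cubeIndices`: every site lies in a cube of the grid), def-R's `Node00/LargeFieldReprOfRecord`
(`unionsOfCubes`, `dCubeSide`, `DOfRecord`, `SeqOfRecord`), def-T's `Node00/Record13` (`PartCompat₁₃`).

WHY THIS FILE.  After dag-n11-d g13 the no-expansion 𝐓-step of N11's (S1ᵀ) conjunct holds, for every parameter of the ZhPin class, from K0's rows (`Provisos₁₃SepCoPH`, per-cube
[15]-solvability `hsolv`), the structural rows (`Admissible`, `s2.Pos`, `0 < M₁ ≤ M`, `1 ≤ M`, window, `PartCompat₁₃`, `1 ≤ k ≤ m + K`), the numerics (`2 ≤ cR`, `h3`, `hR`, `hε`,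
`hε3`, `hε2` — reduced to seven scalar inequalities by dag-n11-w3 g3's `…N11NoExpansionNumerics`), the §2 input, AND the CUBE-COVER ROW `hcov`: at every level `1 ≤ j ≤ k`
and every (2.18) index `s`, `Ω_j(s) ⊆ ⋃ {□ : □ an L M₂ R_j-cube of the (2.17) partition, □ ⊂ Ω_j(s)}`.  dag-n11-d g12 LOCATED it (bus l.27232): it FAILS for K0a's `M = M₂ = 1`
(the χ-cubes `L^{j+1}M₂R_j` are then COARSER than the `𝐃_j`-cubes `L^jMR_j`) and «print has M a multiple of LM₂».  THIS FILE proves exactly that sentence: `Ω_j(s)` is a union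
of `𝐃_j`-cubes (side `dCubeSide L M R_j j = L^j·M·R_j`, `Chain21.memΩ`); if `L·M₂ ∣ M`, say `M = L·M₂·t`, then `L^j·M·R_j = (L^{j+1}·M₂·R_j)·t`, i.e. the `𝐃_j` side is the
partition side `cubeSide L M₂ R_j j` TIMES `t`; and the faces' own `PartCompat₁₃` says the `𝐃_j` grid divides the torus (`dCubeSide … ∣ sitesPerDir 0`).  On the torus two grids
whose sides are `S` and `S·t` with `S·t ∣ sitesPerDir 0` are NESTED (no cube wraps): the `S`-cube of the grid through any point of a union `Λ` of `S·t`-cubes lies inside `Λ`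
(K0b's `cubeEnl_subset_of_meets_unionsOfCubes`), so `Λ` is covered by — indeed equal to the union of — the `S`-cubes it contains.  Hence `hcov` ⟸ `PartCompat₁₃` ∧ `L·M₂ ∣ M`,
and the three faces of p604229 hold with `hcov` REPLACED by the one scalar hypothesis `(hdiv : L * M₂ ∣ M)` (their `hPC` already displayed).

WHAT THIS FILE PROVES (0 `sorry`, 0 `def`; nothing of Bałaban asserted).  §1 (torus geometry, any `Params`): `pos_of_mul_dvd_sitesPerDir` · ★★
`subset_iUnion_cubesIn_of_mem_unionsOfCubes_mul` (a union of `(s·t)`-cubes is covered by the `s`-cubes of the grid it contains, `s·t ∣ sitesPerDir 0`) ·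
`eq_iUnion_cubesIn_of_mem_unionsOfCubes_mul` (… and equals their union) · `mem_unionsOfCubes_of_mem_unionsOfCubes_mul` (the class of unions of `(s·t)`-cubes lies in the class of
unions of `s`-cubes).  §2 (the record's letters): `dCubeSide_eq_cubeSide_mul` (`M = L·M₂·t ⇒ dCubeSide L M R j = cubeSide L M₂ R j · t`) · `cover_at_of_dvd_of_nesting` (one level:
`Ω ∈ 𝐃_j`, the `𝐃_j` grid divides the torus, `L·M₂ ∣ M` ⇒ the cover) · ★★ `cover_row_of_partCompat_of_nesting` (THE ROW: conclusion = p604229's binder `hcov` VERBATIM, all levels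
`1 ≤ j ≤ k`, from `PartCompat₁₃ … k` and `L·M₂ ∣ M` ALONE).  §3 p604229's three faces with `hcov` DISCHARGED and the two trivially redundant structural binders `1 ≤ M`
(⟸ `0 < M₁ ≤ M`) and `k ≤ m + K` (⟸ `k < K`, as `(F.P p.K).K = p.K`) DROPPED (one-line compositions, every other hypothesis and the conclusion VERBATIM): ★★★ `regOn_cutSel_of_zhPin_of_solvable_of_nesting` · ★★★★★ `exists_local_witness_clause_succ_of_sLaw₁₃CoPH_of_zhPin_of_solvable_of_nesting` · ★★★★★
`exists_local_witness_clause_succ_of_hasSect2FormAtZS_of_borelB_of_zhPin_of_solvable_of_nesting`.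

HONEST FRAMING.  Helper lane of K1⁷; kernel bookkeeping (torus ∕ lattice arithmetic); nothing of [III]'s estimates asserted; no law of record edited or posited.  [15]-solvability
(`hsolv`), `Provisos₁₃SepCoPH`, the windows and the numerics stay DISPLAYED; the nesting numeric `L·M₂ ∣ M` is a HYPOTHESIS (K0a's `M = M₂ = 1` meets it iff `L = 1`, i.e. never in
the standing range `L ≥ 2` — dag-n11-d g12's located sentence, now typed).  N11 NOT discharged; K1⁷ NOT closed; counts unmoved (typed 28∕28 · discharged 5∕27).  R4 closes only
the conditional finite-𝕋⁴ rung `BalabanLadder.UV` of one programme at fixed `ε = L^{−K}` — NOT ℝ⁴, NOT OS, NOT a mass gap, NOT Clay.  No `sorry`, `axiom`, `def`, `instance`,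
`notation`.  Sources (SHAPE only): [III] (2.1) p.254 («unions of big cubes»), (2.5) p.255, (2.17)–(2.18) p.257 («the partition of the lattice T_η into cubes of the size LM₂R_k …
compatible with all other partitions»); [I] (0.1) p.251 (the torus).
-/

noncomputable section

open MeasureTheory
open scoped BigOperators ENNReal NNReal Matrix.Norms.L2Operator

namespace Summit.QuantumFields.YangMills.Theorems.BalabanUVNodesN11CubeCoverRowOfNesting

open Literature.MathematicalPhysics.QuantumFieldTheory.Balaban1983to89 T4Continuum T4NestedCovariance Node00 Node00.Tk DagBinding
open B15DeterminingSets B8Eq17ClassAkV1 B14.Eq218Concrete B10Eq42TorusConstraint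
open B14.Eq213MaximalDomains (side)
open B14.Eq213DetSet (Bj)
open Literature.MathematicalPhysics.QuantumFieldTheory.BalabanImbrieJaffe1984to88.BIJ85Eq453GaugeField (qsstarGIter0)
open BalabanUVNodesN11FluctTruncationDefs (IsFluctLocal)
open BalabanUVNodesN11SpaceTruncationDefs BalabanUVNodesN11SpaceTruncationBorelBDefs
open BalabanUVNodesN11HistoryPinnedResidualDefs BalabanUVNodesN11RePinnedParamDefs
open B15Claim189CubePin (cubeOfSite mem_cubeEnl_cubeOfSite cubeOfSite_mem_cubeIndices)
open BalabanUVNodesN11NoExpansionTStepZhPinOfSolvable (regOn_cutSel_of_zhPin_of_solvable exists_local_witness_clause_succ_of_sLaw₁₃CoPH_of_zhPin_of_solvable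
  exists_local_witness_clause_succ_of_hasSect2FormAtZS_of_borelB_of_zhPin_of_solvable)

/-! ## §1  Torus geometry: two grids with sides `s` and `s·t`, `s·t ∣ sitesPerDir 0`, are nested — a union of `(s·t)`-cubes is the union of the `s`-cubes it contains -/

section Geometry

variable {P : Params}

/-- A side whose multiple divides the (positive) number of sites per direction is positive, and so is the factor. [cite: Balaban1987RG1, (0.1) p.251 (bookkeeping)] -/
theorem pos_of_mul_dvd_sitesPerDir {s t : ℕ} (h : s * t ∣ P.sitesPerDir 0) : 0 < s ∧ 0 < t := by
  rcases Nat.eq_zero_or_pos s with hs | hs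
  · exact absurd (Nat.eq_zero_of_zero_dvd (by simpa [hs] using h)) (P.sitesPerDir_ne_zero 0)
  rcases Nat.eq_zero_or_pos t with ht | ht
  · exact absurd (Nat.eq_zero_of_zero_dvd (by simpa [ht] using h)) (P.sitesPerDir_ne_zero 0)
  exact ⟨hs, ht⟩

/-- **★★ A UNION OF `(s·t)`-CUBES IS COVERED BY THE `s`-CUBES OF THE GRID IT CONTAINS** (`s·t ∣ sitesPerDir 0`, so neither grid wraps): the `s`-cube of the grid through a
point `x ∈ Λ` meets `Λ`, hence lies inside it (K0b's `cubeEnl_subset_of_meets_unionsOfCubes`) — print's *«partition … compatible with all other partitions»*.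
[cite: Balaban1988Convergent, (2.17) p.257; Balaban1988Convergent, (2.1) p.254] -/
theorem subset_iUnion_cubesIn_of_mem_unionsOfCubes_mul {s t : ℕ} (hSN : s * t ∣ P.sitesPerDir 0) {Λ : Set (Site P 0)}
    (hΛ : Λ ∈ unionsOfCubes P (s * t)) :
    Λ ⊆ ⋃ a ∈ cubesIn (fun a : ↥(cubeIndices P s) => cubeEnl P s a 0) Λ, cubeEnl P s a 0 := by
  obtain ⟨hs, ht⟩ := pos_of_mul_dvd_sitesPerDir hSN
  intro x hx
  have ha : cubeOfSite s x ∈ cubeIndices P s := cubeOfSite_mem_cubeIndices s hs x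
  have hxa : x ∈ cubeEnl P s (cubeOfSite s x) 0 := mem_cubeEnl_cubeOfSite s hs x
  have hsub : cubeEnl P s (cubeOfSite s x) 0 ⊆ Λ :=
    cubeEnl_subset_of_meets_unionsOfCubes hs ht hSN hΛ ha ⟨x, hxa, hx⟩
  exact Set.mem_iUnion₂.2 ⟨⟨cubeOfSite s x, ha⟩, (mem_cubesIn (fun a : ↥(cubeIndices P s) => cubeEnl P s a 0) Λ _).2 hsub, hxa⟩

/-- … and EQUALS the union of the `s`-cubes of the grid it contains. [cite: Balaban1988Convergent, (2.17) p.257 (bookkeeping)] -/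
theorem eq_iUnion_cubesIn_of_mem_unionsOfCubes_mul {s t : ℕ} (hSN : s * t ∣ P.sitesPerDir 0) {Λ : Set (Site P 0)}
    (hΛ : Λ ∈ unionsOfCubes P (s * t)) :
    Λ = ⋃ a ∈ cubesIn (fun a : ↥(cubeIndices P s) => cubeEnl P s a 0) Λ, cubeEnl P s a 0 :=
  Set.Subset.antisymm (subset_iUnion_cubesIn_of_mem_unionsOfCubes_mul hSN hΛ)
    (Set.iUnion₂_subset fun a ha => (mem_cubesIn (fun a : ↥(cubeIndices P s) => cubeEnl P s a 0) Λ a).1 ha)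

/-- **THE CLASSES ARE NESTED**: a union of `(s·t)`-cubes of the grid is a union of `s`-cubes of the grid (`s·t ∣ sitesPerDir 0`) — `𝐃`-classes for nested sides decrease
in the side. [cite: Balaban1988Convergent, (2.1) p.254, (2.17) p.257 (bookkeeping)] -/
theorem mem_unionsOfCubes_of_mem_unionsOfCubes_mul {s t : ℕ} (hSN : s * t ∣ P.sitesPerDir 0) {Λ : Set (Site P 0)}
    (hΛ : Λ ∈ unionsOfCubes P (s * t)) : Λ ∈ unionsOfCubes P s := by
  classical
  refine ⟨(cubesIn (fun a : ↥(cubeIndices P s) => cubeEnl P s a 0) Λ).image Subtype.val, ?_, ?_⟩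
  · intro a ha
    obtain ⟨a', _, rfl⟩ := Finset.mem_image.1 ha
    exact a'.2
  · rw [Finset.set_biUnion_finset_image]
    exact eq_iUnion_cubesIn_of_mem_unionsOfCubes_mul hSN hΛ

end Geometry

/-! ## §2  The record's letters: `𝐃_j`-cubes vs the (2.17) partition cubes under the nesting numeric `L·M₂ ∣ M`; THE ROW -/

/-- `M = L·M₂·t ⇒ L^j·M·R_j = (L^{j+1}·M₂·R_j)·t`: the `𝐃_j` cube side is the (2.17) partition side times `t`. [cite: Balaban1988Convergent, (2.1) p.254, (2.17) p.257 (bookkeeping)] -/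
theorem dCubeSide_eq_cubeSide_mul {L M₂ M t : ℕ} (hM : M = L * M₂ * t) (R j : ℕ) :
    dCubeSide L M R j = cubeSide L M₂ R j * t := by
  subst hM
  unfold dCubeSide cubeSide
  ring

variable {F : T4Family} {N : ℕ} [NeZero N]

/-- **ONE LEVEL**: a region of `𝐃_j` of record (a union of `L^j·M·R_j`-cubes) whose grid divides the torus is covered by the `L^{j+1}·M₂·R_j`-cubes of the (2.17) partition it
contains, as soon as `L·M₂ ∣ M`. [cite: Balaban1988Convergent, (2.1) p.254, (2.5) p.255, (2.17) p.257] -/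
theorem cover_at_of_dvd_of_nesting (ν : Stage7Numerics) {M : ℕ} (g : ℕ → ℝ) (K j : ℕ) (hdiv : (F.P K).L * ν.M₂ ∣ M)
    (hPC : dCubeSide (F.P K).L M (RkOfRecord (F.P K).L ν.r (g j)) j ∣ (F.P K).sitesPerDir 0)
    {Ω : Set (Site (F.P K) 0)} (hΩ : Ω ∈ DOfRecord F ν M g K j) :
    Ω ⊆ ⋃ a ∈ cubesIn (fun a : ↥(cubeIndices (F.P K) (cubeSide (F.P K).L ν.M₂ (RkOfRecord (F.P K).L ν.r (g j)) j)) =>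
        cubeEnl (F.P K) (cubeSide (F.P K).L ν.M₂ (RkOfRecord (F.P K).L ν.r (g j)) j) a 0) Ω,
      cubeEnl (F.P K) (cubeSide (F.P K).L ν.M₂ (RkOfRecord (F.P K).L ν.r (g j)) j) a 0 := by
  obtain ⟨t, ht⟩ := hdiv
  have hside := dCubeSide_eq_cubeSide_mul ht (RkOfRecord (F.P K).L ν.r (g j)) j
  have hΩ' : Ω ∈ unionsOfCubes (F.P K) (cubeSide (F.P K).L ν.M₂ (RkOfRecord (F.P K).L ν.r (g j)) j * t) := by
    have h' : Ω ∈ unionsOfCubes (F.P K) (dCubeSide (F.P K).L M (RkOfRecord (F.P K).L ν.r (g j)) j) := hΩ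
    rwa [hside] at h'
  rw [hside] at hPC
  exact subset_iUnion_cubesIn_of_mem_unionsOfCubes_mul hPC hΩ'

variable (θ : Stage13HParams F N) (p : B12.RunParams)

/-- **★★ THE CUBE-COVER ROW OF THE NO-EXPANSION 𝐓-STEP FROM `PartCompat₁₃` AND THE NESTING NUMERIC `L·M₂ ∣ M` ALONE** — conclusion = dag-n11-d's binder `hcov` of
`…N11NoExpansionTStepZhPinOfSolvable` VERBATIM (all levels `1 ≤ j ≤ k`, every (2.18) index `s` of length `j`: `Ω_j(s) ∈ 𝐃_j` by `Chain21.memΩ`).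
[cite: Balaban1988Convergent, (2.1) p.254, (2.5) p.255, (2.17)–(2.18) p.257] -/
theorem cover_row_of_partCompat_of_nesting (hdiv : (F.P p.K).L * θ.ν.M₂ ∣ θ.τ9.M) {k : ℕ} (hPC : PartCompat₁₃ F N θ.toStage13Params p k) :
    ∀ j, 1 ≤ j → j ≤ k → ∀ s : SeqOfRecord F θ.ν θ.τ9.M (gOfRecord₁₃ F N θ.toStage13Params p) p.K j,
      s.Ω j ⊆ ⋃ a ∈ cubesIn (fun a : ↥(cubeIndices (F.P p.K) (cubeSide (F.P p.K).L θ.ν.M₂ (RkOfRecord (F.P p.K).L θ.ν.r (gOfRecord₁₃ F N θ.toStage13Params p j)) j)) =>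
          cubeEnl (F.P p.K) (cubeSide (F.P p.K).L θ.ν.M₂ (RkOfRecord (F.P p.K).L θ.ν.r (gOfRecord₁₃ F N θ.toStage13Params p j)) j) a 0) (s.Ω j),
        cubeEnl (F.P p.K) (cubeSide (F.P p.K).L θ.ν.M₂ (RkOfRecord (F.P p.K).L θ.ν.r (gOfRecord₁₃ F N θ.toStage13Params p j)) j) a 0 := by
  intro j h1 hj s
  exact cover_at_of_dvd_of_nesting θ.ν (gOfRecord₁₃ F N θ.toStage13Params p) p.K j hdiv (hPC j h1 hj) (s.chain.memΩ j h1 le_rfl)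

/-! ## §3  dag-n11-d g13's three faces with the cube-cover row DISCHARGED (`hcov` ↦ `hdiv : L·M₂ ∣ M`), and the two trivially redundant structural binders dropped
(`1 ≤ M` ⟸ `0 < M₁ ≤ M`; `k ≤ m + K` ⟸ `k < K` resp. `k ≤ K`, since `(F.P p.K).K = p.K`); everything else VERBATIM -/

/-- **★★★ 12a″'s READING-REGION LAW ON THE CUT SELECTOR, IN THE ZhPin CLASS, FROM [15]-SOLVABILITY — CUBE COVER DISCHARGED**: p604229's `regOn_cutSel_of_zhPin_of_solvable` with
`hcov` replaced by `PartCompat₁₃ … k` and `L·M₂ ∣ M` (and `k ≤ m + K` derived from `k ≤ K`). [cite: Balaban1988Convergent, (2.2) p.255, (2.10) p.256, (2.16)–(2.17) p.257, (3.16) p.268; Balaban1985Variational, Thm 1 (7)–(8) pp.278–279; Balaban1985Averaging, Prop. 2 p.26] -/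
theorem regOn_cutSel_of_zhPin_of_solvable_of_nesting
    (hζ0 : ∀ (p' : B12.RunParams) (n : ℕ) (Ω Λ : ℕ → Set (Site (F.P p'.K) 0)), (θ.Zh p' n Ω Λ).ζ0 = (ZhPinOfRecord₁₃ θ.toStage13Params p' Ω Λ).ζ0)
    {k : ℕ} (hkK : k ≤ p.K) (hcR : 2 ≤ θ.s2.cR) (hM : 1 ≤ θ.ν.M₁)
    (hPC : PartCompat₁₃ F N θ.toStage13Params p k) (hdiv : (F.P p.K).L * θ.ν.M₂ ∣ θ.τ9.M)
    (h3 : ∀ j, 1 ≤ j → j ≤ k →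
      3 * side (F.P p.K).L θ.ν.M₁ j ≤ cubeSide (F.P p.K).L θ.ν.M₂ (RkOfRecord (F.P p.K).L θ.ν.r (gOfRecord₁₃ F N θ.toStage13Params p j)) j)
    (hR : ∀ j, 1 ≤ j → j ≤ k → (F.P p.K).L ^ j + (((F.P p.K).d + 4) * (F.P p.K).L + 2) * (∑ l ∈ Finset.range j, (F.P p.K).L ^ l) + 2 ≤
      cubeSide (F.P p.K).L θ.ν.M₂ (RkOfRecord (F.P p.K).L θ.ν.r (gOfRecord₁₃ F N θ.toStage13Params p j)) j)
    (hε : ∀ j, 1 ≤ j → j ≤ k → 0 < epsOfRecord θ.ν (gOfRecord₁₃ F N θ.toStage13Params p) j)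
    (hε3 : ∀ j, 1 ≤ j → j ≤ k → (143 * (((((F.P p.K).d + 4 : ℕ) : ℝ)) ^ 2 / 4) ^ 2) * epsOfRecord θ.ν (gOfRecord₁₃ F N θ.toStage13Params p) j ≤ 1 / 3)
    (hε2 : ∀ j, 1 ≤ j → j ≤ k →
      2 * epsOfRecord θ.ν (gOfRecord₁₃ F N θ.toStage13Params p) j ≤ 2 * ExpMeanLog.deltaSU (Fin N) / ((((F.P p.K).d + 4) * (F.P p.K).L : ℕ) : ℝ) ^ 2)
    (hsolv : ∀ j, 1 ≤ j → j ≤ k → ∀ (s : SeqOfRecord F θ.ν θ.τ9.M (gOfRecord₁₃ F N θ.toStage13Params p) p.K j) (V : GaugeField (F.P p.K) j (SU N)),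
      chiSeqOfRecord F N θ.ν θ.τ9.M (gOfRecord₁₃ F N θ.toStage13Params p) p.K j s V ≠ 0 →
      ∀ a ∈ cubesIn (fun a : ↥(cubeIndices (F.P p.K) (cubeSide (F.P p.K).L θ.ν.M₂ (RkOfRecord (F.P p.K).L θ.ν.r (gOfRecord₁₃ F N θ.toStage13Params p j)) j)) =>
          cubeEnl (F.P p.K) (cubeSide (F.P p.K).L θ.ν.M₂ (RkOfRecord (F.P p.K).L θ.ν.r (gOfRecord₁₃ F N θ.toStage13Params p j)) j) a 0) (s.Ω j),
        ∃ U₀, IsMinimizer (avOfRecord F N p.K) {U | PlaqSmall (θ.ν.εreg * (F.P p.K).eta j ^ 2) U}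
          (Bj θ.ν.M₁ (cubeEnl (F.P p.K) (cubeSide (F.P p.K).L θ.ν.M₂ (RkOfRecord (F.P p.K).L θ.ν.r (gOfRecord₁₃ F N θ.toStage13Params p j)) j) a 4) j)
          (avgFamily (avOfRecord F N p.K) (qsstarGIter0 j V)) U₀)
    (s₀ : SeqOfRecord F θ.ν θ.τ9.M (gOfRecord₁₃ F N θ.toStage13Params p) p.K k) :
    (θ.zhAt p s₀).RegOn F N (FluctV N) θ.ν θ.s2.cR p (gOfRecord₁₃ F N θ.toStage13Params p)
      (fun j Y => {x | (j < k ∧ Y = (s₀.Ω (j + 1))ᶜ) ∧ x ∈ readSelOfSeq F p (suppDomOfRecord F θ.ν p.K s₀.Ω) s₀.Ω j Y}) :=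
  regOn_cutSel_of_zhPin_of_solvable θ p hζ0 hkK (hkK.trans (Nat.le_add_left _ _)) hcR hM h3 hR hε hε3 hε2 hsolv
    (cover_row_of_partCompat_of_nesting θ p hdiv hPC) s₀

/-- **★★★★★ THE NO-EXPANSION 𝐓-STEP IN THE ZhPin CLASS FROM K0's ROWS AND THE STRUCTURAL ROWS — CUBE COVER DISCHARGED** (SLaw-keyed): p604229's face with `hcov` replaced by the
scalar `L·M₂ ∣ M` (its `hPC` serves) and the binders `1 ≤ M`, `k ≤ m + K` derived (`0 < M₁ ≤ M`, `k < K`); conclusion VERBATIM. [cite: Balaban1988Convergent, Theorem p.245, Thm 1 p.262, (2.1)–(2.2) pp.254–255, (2.7) p.255, (2.10) p.256, (2.16)–(2.18) p.257, (2.20)–(2.28) pp.258–259, (3.5) p.265, (3.16) p.268, (3.24)–(3.25) p.270; Balaban1985Variational, Thm 1 (7)–(8) pp.278–279; Balaban1985Averaging, Prop. 2 p.26; Balaban1985RegularSpaces, (1.3)–(1.6) p.77] -/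
theorem exists_local_witness_clause_succ_of_sLaw₁₃CoPH_of_zhPin_of_solvable_of_nesting (hζ0 : ∀ (p' : B12.RunParams) (n : ℕ) (Ω Λ : ℕ → Set (Site (F.P p'.K) 0)), (θ.Zh p' n Ω Λ).ζ0 = (ZhPinOfRecord₁₃ θ.toStage13Params p' Ω Λ).ζ0)
    (h : θ.Provisos₁₃SepCoPH F N) (hθ : θ.Admissible F N)
    (hpos : θ.s2.Pos) (hM₁ : 0 < θ.ν.M₁) (hle : θ.ν.M₁ ≤ θ.τ9.M) {k : ℕ} (hk : k < p.K)
    (hw : Step.InInterval θ.γ k (gOfRecord₁₃ F N θ.toStage13Params p)) (hPC : PartCompat₁₃ F N θ.toStage13Params p k)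
    (hk1 : 1 ≤ k) (hcR : 2 ≤ θ.s2.cR) (hdiv : (F.P p.K).L * θ.ν.M₂ ∣ θ.τ9.M)
    (h3 : ∀ j, 1 ≤ j → j ≤ k →
      3 * side (F.P p.K).L θ.ν.M₁ j ≤ cubeSide (F.P p.K).L θ.ν.M₂ (RkOfRecord (F.P p.K).L θ.ν.r (gOfRecord₁₃ F N θ.toStage13Params p j)) j)
    (hR : ∀ j, 1 ≤ j → j ≤ k → (F.P p.K).L ^ j + (((F.P p.K).d + 4) * (F.P p.K).L + 2) * (∑ l ∈ Finset.range j, (F.P p.K).L ^ l) + 2 ≤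
      cubeSide (F.P p.K).L θ.ν.M₂ (RkOfRecord (F.P p.K).L θ.ν.r (gOfRecord₁₃ F N θ.toStage13Params p j)) j)
    (hε : ∀ j, 1 ≤ j → j ≤ k → 0 < epsOfRecord θ.ν (gOfRecord₁₃ F N θ.toStage13Params p) j)
    (hε3 : ∀ j, 1 ≤ j → j ≤ k → (143 * (((((F.P p.K).d + 4 : ℕ) : ℝ)) ^ 2 / 4) ^ 2) * epsOfRecord θ.ν (gOfRecord₁₃ F N θ.toStage13Params p) j ≤ 1 / 3)
    (hε2 : ∀ j, 1 ≤ j → j ≤ k →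
      2 * epsOfRecord θ.ν (gOfRecord₁₃ F N θ.toStage13Params p) j ≤ 2 * ExpMeanLog.deltaSU (Fin N) / ((((F.P p.K).d + 4) * (F.P p.K).L : ℕ) : ℝ) ^ 2)
    (hsolv : ∀ j, 1 ≤ j → j ≤ k → ∀ (s : SeqOfRecord F θ.ν θ.τ9.M (gOfRecord₁₃ F N θ.toStage13Params p) p.K j) (V : GaugeField (F.P p.K) j (SU N)),
      chiSeqOfRecord F N θ.ν θ.τ9.M (gOfRecord₁₃ F N θ.toStage13Params p) p.K j s V ≠ 0 →
      ∀ a ∈ cubesIn (fun a : ↥(cubeIndices (F.P p.K) (cubeSide (F.P p.K).L θ.ν.M₂ (RkOfRecord (F.P p.K).L θ.ν.r (gOfRecord₁₃ F N θ.toStage13Params p j)) j)) =>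
          cubeEnl (F.P p.K) (cubeSide (F.P p.K).L θ.ν.M₂ (RkOfRecord (F.P p.K).L θ.ν.r (gOfRecord₁₃ F N θ.toStage13Params p j)) j) a 0) (s.Ω j),
        ∃ U₀, IsMinimizer (avOfRecord F N p.K) {U | PlaqSmall (θ.ν.εreg * (F.P p.K).eta j ^ 2) U}
          (Bj θ.ν.M₁ (cubeEnl (F.P p.K) (cubeSide (F.P p.K).L θ.ν.M₂ (RkOfRecord (F.P p.K).L θ.ν.r (gOfRecord₁₃ F N θ.toStage13Params p j)) j) a 4) j)
          (avgFamily (avOfRecord F N p.K) (qsstarGIter0 j V)) U₀)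
    (hS : SLaw₁₃CoPH F N θ p k) :
    ∃ (t : SeqOfRecord F θ.ν θ.τ9.M (gOfRecord₁₃ F N θ.toStage13Params p) p.K k → Sect2.TermValues (F.P p.K) (MatA N) (FluctV N) θ.τ9.M)
      (Ek : SeqOfRecord F θ.ν θ.τ9.M (gOfRecord₁₃ F N θ.toStage13Params p) p.K k → ℝ),
      HasSect2FormAtZS F N (FluctV N) p.K (settingOfRecord₁₃ F N θ.toStage13Params p) k (θ.rzAt p) (WtOfRecord₁₃H F N θ p)
          (UbgOfRecord₁₃CoP F N θ.toStage13Params p k)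
          (fun s₀ t₀ => Sect2.LawsRT (sect2TowerOfRecord F N (FluctV N) p.K (settingOfRecord₁₃ F N θ.toStage13Params p) (θ.rzAt p s₀) s₀ t₀)
            (settingOfRecord₁₃ F N θ.toStage13Params p).lf k)
          (slotsOfRecord F N θ.ν θ.τ9 (EOfRecord₁₃ F N θ.toStage13Params) (wOfRecord₉ F N θ.toStage9Params) θ.ppSel p
            (gOfRecord₁₃ F N θ.toStage13Params p) k) t Ek ∧
      (∀ s₀, IsFluctLocal k (t s₀)) ∧
      ∀ (s : SeqOfRecord F θ.ν θ.τ9.M (gOfRecord₁₃ F N θ.toStage13Params p) p.K (k + 1)), s.Ω (k + 1) = ∅ →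
        -- (P) prefix agreement below `k`
        (∀ j, j < k → (θ.zhAt p s).ζ0 j = (θ.zhAt p s.init).ζ0 j ∧ (θ.zhAt p s).quad j = (θ.zhAt p s.init).quad j) →
        -- (V) the generation-`k` pin with the old front factor
        (∀ (V' : GaugeField (F.P p.K) (k + 1) (SU N)) (U₀ : GaugeField (F.P p.K) k (SU N)),
          (θ.zhAt p s).ζ0 k Set.univ (pairCfgAt (V := FluctV N) k V' U₀) =
            chiSeqOfRecord F N θ.ν θ.τ9.M (gOfRecord₁₃ F N θ.toStage13Params p) p.K k s.init U₀ *
              wOfRecord₉ F N θ.toStage9Params p (gOfRecord₁₃ F N θ.toStage13Params p) k s U₀ ((avOfRecord F N p.K k).avg U₀)) →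
        -- `quad_k(∅) = 0` on the two-scale configurations
        (∀ (V' : GaugeField (F.P p.K) (k + 1) (SU N)) (U₀ : GaugeField (F.P p.K) k (SU N)), (θ.zhAt p s).quad k ∅ (pairCfgAt (V := FluctV N) k V' U₀) = 0) →
        -- `k`-locality of `quad_j(Λ_{j+1})`, `j < k`
        (∀ j, j < k → ∀ ω ω' : MultiCfg (F.P p.K) (SU N) (FluctV N), (∀ i, i ≤ k → ω i = ω' i) →
          (θ.zhAt p s).quad j (s.init.Λ (j + 1)) ω = (θ.zhAt p s).quad j (s.init.Λ (j + 1)) ω') →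
        -- measurability of the residual serving `s′`
        (∀ j (Y : Set (Site (F.P p.K) 0)), Measurable ((θ.zhAt p s).ζ0 j Y)) →
        (∀ j (Λ' : Set (Site (F.P p.K) 0)), Measurable ((θ.zhAt p s).quad j Λ')) →
        -- per old branch: A-fibre domination (K0b)
        (∀ S ∈ admSOfRecord F θ.ν θ.τ9.M (gOfRecord₁₃ F N θ.toStage13Params p) p.K k s.init, ∀ j : ℕ,
          ∃ ŵ : (↥(Set.toFinite (B10Eq42TorusConstraint.bondsIn j ((s.init.Λ (j + 1))ᶜ ∩ s.init.Ω (j + 1)))).toFinset → FluctV N) → ℝ≥0∞, Measurable ŵ ∧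
            (∫⁻ a, ŵ a ∂(Measure.pi fun _ : ↥(Set.toFinite (B10Eq42TorusConstraint.bondsIn j ((s.init.Λ (j + 1))ᶜ ∩ s.init.Ω (j + 1)))).toFinset => (volume : Measure (FluctV N)))) ≠ ⊤ ∧
            ∀ ω, ENNReal.ofReal ((WtOfRecord₁₃H F N θ p s).w j (s.init.Λ (j + 1)) ((s.init.Λ (j + 1))ᶜ ∩ s.init.Ω (j + 1)) (S (j + 1)) ω) ≤
              ŵ (fun b : ↥(Set.toFinite (B10Eq42TorusConstraint.bondsIn j ((s.init.Λ (j + 1))ᶜ ∩ s.init.Ω (j + 1)))).toFinset => (ω j).2 b)) →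
        -- def-T: the 𝐁-terms of the witness at the parent history, READ AT THE EMBEDDED BACKGROUND, are JOINTLY measurable in `(U, A)` (LOCATED residue)
        (∀ (S' : ℕ → Set (Site (F.P p.K) 0)) (j : ℕ) (X : (Sect2.domSys (F.P p.K) θ.τ9.M j).Dom),
          Measurable (fun q : GaugeField (F.P p.K) 0 (SU N) × MSFluct (F.P p.K) (FluctV N) =>
            ((t s.init).B j X (Sect2.ofBackgroundC (settingOfRecord₁₃ F N θ.toStage13Params p).ι q.1) (S', q.2)).re)) →
        (slotsTOfRecord F N θ.ν θ.τ9 (EOfRecord₁₃ F N θ.toStage13Params) (wOfRecord₉ F N θ.toStage9Params) θ.ppSel p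
            (gOfRecord₁₃ F N θ.toStage13Params p) (k + 1) s = 0 ∨
          ∀ᵐ V' ∂fieldMeasure (F.P p.K) (k + 1) (SU N),
            chiSeqOfRecord F N θ.ν θ.τ9.M (gOfRecord₁₃ F N θ.toStage13Params p) p.K (k + 1) s V' ≠ 0 →
              slotsTOfRecord F N θ.ν θ.τ9 (EOfRecord₁₃ F N θ.toStage13Params) (wOfRecord₉ F N θ.toStage9Params) θ.ppSel p
                  (gOfRecord₁₃ F N θ.toStage13Params p) (k + 1) s V' =
                sect2Slot F N (FluctV N) p.K (settingOfRecord₁₃ F N θ.toStage13Params p) (θ.rzAt p s) (WtOfRecord₁₃H F N θ p s) s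
                  (t s.init) (Ek s.init) (UbgOfRecord₁₃CoP F N θ.toStage13Params p (k + 1) s) V') :=
  exists_local_witness_clause_succ_of_sLaw₁₃CoPH_of_zhPin_of_solvable θ p hζ0 h hθ hpos hM₁ hle hk (Nat.lt_of_lt_of_le hM₁ hle) hw hPC hk1
    (hk.le.trans (Nat.le_add_left _ _)) hcR h3 hR hε hε3 hε2 hsolv (cover_row_of_partCompat_of_nesting θ p hdiv hPC) hS

/-- **★★★★★ THE WITNESS-FIRST NO-EXPANSION 𝐓-STEP IN THE ZhPin CLASS FROM K0's ROWS AND THE STRUCTURAL ROWS — CUBE COVER DISCHARGED**: p604229's witness-first face with `hcov`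
replaced by the scalar `L·M₂ ∣ M` (its `hPC` serves) and the binders `1 ≤ M`, `k ≤ m + K` derived (`0 < M₁ ≤ M`, `k < K`); conclusion VERBATIM. [cite: Balaban1988Convergent, Theorem p.245, Thm 1 p.262, (2.1)–(2.2) pp.254–255, (2.7) p.255, (2.10) p.256, (2.16)–(2.18) p.257, (2.20)–(2.28) pp.258–259, (3.5) p.265, (3.16) p.268, (3.24)–(3.25) p.270; Balaban1985Variational, Thm 1 (7)–(8) pp.278–279; Balaban1985Averaging, Prop. 2 p.26; Balaban1985RegularSpaces, (1.3)–(1.6) p.77; Balaban1987RG1, Thm 3 p.264] -/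
theorem exists_local_witness_clause_succ_of_hasSect2FormAtZS_of_borelB_of_zhPin_of_solvable_of_nesting (hζ0 : ∀ (p' : B12.RunParams) (n : ℕ) (Ω Λ : ℕ → Set (Site (F.P p'.K) 0)), (θ.Zh p' n Ω Λ).ζ0 = (ZhPinOfRecord₁₃ θ.toStage13Params p' Ω Λ).ζ0)
    (h : θ.Provisos₁₃SepCoPH F N) (hθ : θ.Admissible F N)
    (hpos : θ.s2.Pos) (hM₁ : 0 < θ.ν.M₁) (hle : θ.ν.M₁ ≤ θ.τ9.M) {k : ℕ} (hk : k < p.K)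
    (hw : Step.InInterval θ.γ k (gOfRecord₁₃ F N θ.toStage13Params p)) (hPC : PartCompat₁₃ F N θ.toStage13Params p k)
    (hk1 : 1 ≤ k) (hcR : 2 ≤ θ.s2.cR) (hdiv : (F.P p.K).L * θ.ν.M₂ ∣ θ.τ9.M)
    (h3 : ∀ j, 1 ≤ j → j ≤ k →
      3 * side (F.P p.K).L θ.ν.M₁ j ≤ cubeSide (F.P p.K).L θ.ν.M₂ (RkOfRecord (F.P p.K).L θ.ν.r (gOfRecord₁₃ F N θ.toStage13Params p j)) j)
    (hR : ∀ j, 1 ≤ j → j ≤ k → (F.P p.K).L ^ j + (((F.P p.K).d + 4) * (F.P p.K).L + 2) * (∑ l ∈ Finset.range j, (F.P p.K).L ^ l) + 2 ≤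
      cubeSide (F.P p.K).L θ.ν.M₂ (RkOfRecord (F.P p.K).L θ.ν.r (gOfRecord₁₃ F N θ.toStage13Params p j)) j)
    (hε : ∀ j, 1 ≤ j → j ≤ k → 0 < epsOfRecord θ.ν (gOfRecord₁₃ F N θ.toStage13Params p) j)
    (hε3 : ∀ j, 1 ≤ j → j ≤ k → (143 * (((((F.P p.K).d + 4 : ℕ) : ℝ)) ^ 2 / 4) ^ 2) * epsOfRecord θ.ν (gOfRecord₁₃ F N θ.toStage13Params p) j ≤ 1 / 3)
    (hε2 : ∀ j, 1 ≤ j → j ≤ k →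
      2 * epsOfRecord θ.ν (gOfRecord₁₃ F N θ.toStage13Params p) j ≤ 2 * ExpMeanLog.deltaSU (Fin N) / ((((F.P p.K).d + 4) * (F.P p.K).L : ℕ) : ℝ) ^ 2)
    (hsolv : ∀ j, 1 ≤ j → j ≤ k → ∀ (s : SeqOfRecord F θ.ν θ.τ9.M (gOfRecord₁₃ F N θ.toStage13Params p) p.K j) (V : GaugeField (F.P p.K) j (SU N)),
      chiSeqOfRecord F N θ.ν θ.τ9.M (gOfRecord₁₃ F N θ.toStage13Params p) p.K j s V ≠ 0 →
      ∀ a ∈ cubesIn (fun a : ↥(cubeIndices (F.P p.K) (cubeSide (F.P p.K).L θ.ν.M₂ (RkOfRecord (F.P p.K).L θ.ν.r (gOfRecord₁₃ F N θ.toStage13Params p j)) j)) =>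
          cubeEnl (F.P p.K) (cubeSide (F.P p.K).L θ.ν.M₂ (RkOfRecord (F.P p.K).L θ.ν.r (gOfRecord₁₃ F N θ.toStage13Params p j)) j) a 0) (s.Ω j),
        ∃ U₀, IsMinimizer (avOfRecord F N p.K) {U | PlaqSmall (θ.ν.εreg * (F.P p.K).eta j ^ 2) U}
          (Bj θ.ν.M₁ (cubeEnl (F.P p.K) (cubeSide (F.P p.K).L θ.ν.M₂ (RkOfRecord (F.P p.K).L θ.ν.r (gOfRecord₁₃ F N θ.toStage13Params p j)) j) a 4) j)
          (avgFamily (avOfRecord F N p.K) (qsstarGIter0 j V)) U₀)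
    (t₀ : SeqOfRecord F θ.ν θ.τ9.M (gOfRecord₁₃ F N θ.toStage13Params p) p.K k → Sect2.TermValues (F.P p.K) (MatA N) (FluctV N) θ.τ9.M)
    (E₀ : SeqOfRecord F θ.ν θ.τ9.M (gOfRecord₁₃ F N θ.toStage13Params p) p.K k → ℝ)
    (hform₀ : HasSect2FormAtZS F N (FluctV N) p.K (settingOfRecord₁₃ F N θ.toStage13Params p) k (θ.rzAt p) (WtOfRecord₁₃H F N θ p)
      (UbgOfRecord₁₃CoP F N θ.toStage13Params p k)
      (fun s₀ t' => Sect2.LawsRT (sect2TowerOfRecord F N (FluctV N) p.K (settingOfRecord₁₃ F N θ.toStage13Params p) (θ.rzAt p s₀) s₀ t')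
        (settingOfRecord₁₃ F N θ.toStage13Params p).lf k)
      (slotsOfRecord F N θ.ν θ.τ9 (EOfRecord₁₃ F N θ.toStage13Params) (wOfRecord₉ F N θ.toStage9Params) θ.ppSel p (gOfRecord₁₃ F N θ.toStage13Params p) k) t₀ E₀)
    (hBt : ∀ s₀ (S' : ℕ → Set (Site (F.P p.K) 0)) (j : ℕ) (X : (Sect2.domSys (F.P p.K) θ.τ9.M j).Dom),
      Measurable (fun q : GaugeField (F.P p.K) 0 (SU N) × MSFluct (F.P p.K) (FluctV N) =>
        (t₀ s₀).B j X (Sect2.ofBackgroundC (settingOfRecord₁₃ F N θ.toStage13Params p).ι q.1) (S', q.2))) :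
    ∃ (t : SeqOfRecord F θ.ν θ.τ9.M (gOfRecord₁₃ F N θ.toStage13Params p) p.K k → Sect2.TermValues (F.P p.K) (MatA N) (FluctV N) θ.τ9.M)
      (Ek : SeqOfRecord F θ.ν θ.τ9.M (gOfRecord₁₃ F N θ.toStage13Params p) p.K k → ℝ),
      HasSect2FormAtZS F N (FluctV N) p.K (settingOfRecord₁₃ F N θ.toStage13Params p) k (θ.rzAt p) (WtOfRecord₁₃H F N θ p)
          (UbgOfRecord₁₃CoP F N θ.toStage13Params p k)
          (fun s₀ t₀ => Sect2.LawsRT (sect2TowerOfRecord F N (FluctV N) p.K (settingOfRecord₁₃ F N θ.toStage13Params p) (θ.rzAt p s₀) s₀ t₀)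
            (settingOfRecord₁₃ F N θ.toStage13Params p).lf k)
          (slotsOfRecord F N θ.ν θ.τ9 (EOfRecord₁₃ F N θ.toStage13Params) (wOfRecord₉ F N θ.toStage9Params) θ.ppSel p
            (gOfRecord₁₃ F N θ.toStage13Params p) k) t Ek ∧
      (∀ s₀, IsFluctLocal k (t s₀)) ∧
      ∀ (s : SeqOfRecord F θ.ν θ.τ9.M (gOfRecord₁₃ F N θ.toStage13Params p) p.K (k + 1)), s.Ω (k + 1) = ∅ →
        -- (P) prefix agreement below `k`
        (∀ j, j < k → (θ.zhAt p s).ζ0 j = (θ.zhAt p s.init).ζ0 j ∧ (θ.zhAt p s).quad j = (θ.zhAt p s.init).quad j) →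
        -- (V) the generation-`k` pin with the old front factor
        (∀ (V' : GaugeField (F.P p.K) (k + 1) (SU N)) (U₀ : GaugeField (F.P p.K) k (SU N)),
          (θ.zhAt p s).ζ0 k Set.univ (pairCfgAt (V := FluctV N) k V' U₀) =
            chiSeqOfRecord F N θ.ν θ.τ9.M (gOfRecord₁₃ F N θ.toStage13Params p) p.K k s.init U₀ *
              wOfRecord₉ F N θ.toStage9Params p (gOfRecord₁₃ F N θ.toStage13Params p) k s U₀ ((avOfRecord F N p.K k).avg U₀)) →
        -- `quad_k(∅) = 0` on the two-scale configurations
        (∀ (V' : GaugeField (F.P p.K) (k + 1) (SU N)) (U₀ : GaugeField (F.P p.K) k (SU N)), (θ.zhAt p s).quad k ∅ (pairCfgAt (V := FluctV N) k V' U₀) = 0) →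
        -- `k`-locality of `quad_j(Λ_{j+1})`, `j < k`
        (∀ j, j < k → ∀ ω ω' : MultiCfg (F.P p.K) (SU N) (FluctV N), (∀ i, i ≤ k → ω i = ω' i) →
          (θ.zhAt p s).quad j (s.init.Λ (j + 1)) ω = (θ.zhAt p s).quad j (s.init.Λ (j + 1)) ω') →
        -- measurability of the residual serving `s′`
        (∀ j (Y : Set (Site (F.P p.K) 0)), Measurable ((θ.zhAt p s).ζ0 j Y)) →
        (∀ j (Λ' : Set (Site (F.P p.K) 0)), Measurable ((θ.zhAt p s).quad j Λ')) →
        -- per old branch: A-fibre domination (K0b)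
        (∀ S ∈ admSOfRecord F θ.ν θ.τ9.M (gOfRecord₁₃ F N θ.toStage13Params p) p.K k s.init, ∀ j : ℕ,
          ∃ ŵ : (↥(Set.toFinite (B10Eq42TorusConstraint.bondsIn j ((s.init.Λ (j + 1))ᶜ ∩ s.init.Ω (j + 1)))).toFinset → FluctV N) → ℝ≥0∞, Measurable ŵ ∧
            (∫⁻ a, ŵ a ∂(Measure.pi fun _ : ↥(Set.toFinite (B10Eq42TorusConstraint.bondsIn j ((s.init.Λ (j + 1))ᶜ ∩ s.init.Ω (j + 1)))).toFinset => (volume : Measure (FluctV N)))) ≠ ⊤ ∧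
            ∀ ω, ENNReal.ofReal ((WtOfRecord₁₃H F N θ p s).w j (s.init.Λ (j + 1)) ((s.init.Λ (j + 1))ᶜ ∩ s.init.Ω (j + 1)) (S (j + 1)) ω) ≤
              ŵ (fun b : ↥(Set.toFinite (B10Eq42TorusConstraint.bondsIn j ((s.init.Λ (j + 1))ᶜ ∩ s.init.Ω (j + 1)))).toFinset => (ω j).2 b)) →
        (slotsTOfRecord F N θ.ν θ.τ9 (EOfRecord₁₃ F N θ.toStage13Params) (wOfRecord₉ F N θ.toStage9Params) θ.ppSel p
            (gOfRecord₁₃ F N θ.toStage13Params p) (k + 1) s = 0 ∨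
          ∀ᵐ V' ∂fieldMeasure (F.P p.K) (k + 1) (SU N),
            chiSeqOfRecord F N θ.ν θ.τ9.M (gOfRecord₁₃ F N θ.toStage13Params p) p.K (k + 1) s V' ≠ 0 →
              slotsTOfRecord F N θ.ν θ.τ9 (EOfRecord₁₃ F N θ.toStage13Params) (wOfRecord₉ F N θ.toStage9Params) θ.ppSel p
                  (gOfRecord₁₃ F N θ.toStage13Params p) (k + 1) s V' =
                sect2Slot F N (FluctV N) p.K (settingOfRecord₁₃ F N θ.toStage13Params p) (θ.rzAt p s) (WtOfRecord₁₃H F N θ p s) s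
                  (t s.init) (Ek s.init) (UbgOfRecord₁₃CoP F N θ.toStage13Params p (k + 1) s) V') :=
  exists_local_witness_clause_succ_of_hasSect2FormAtZS_of_borelB_of_zhPin_of_solvable θ p hζ0 h hθ hpos hM₁ hle hk (Nat.lt_of_lt_of_le hM₁ hle) hw hPC
    hk1 (hk.le.trans (Nat.le_add_left _ _)) hcR h3 hR hε hε3 hε2 hsolv (cover_row_of_partCompat_of_nesting θ p hdiv hPC) t₀ E₀ hform₀ hBt

end Summit.QuantumFields.YangMills.Theorems.BalabanUVNodesN11CubeCoverRowOfNesting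

end
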